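import Summits.AtomisticToContinuum.HydrodynamicLimit.Theorems.ImplosionDichotomyTypeOneIdealImplosion
import Literature.Analysis.FluidPDE.CompressibleEulerImplosionShooting
import Literature.Analysis.FluidPDE.CompressibleEulerImplosionLeftAssembly

/-!
# `TypeOneIdealImplosion` from the certified left-barrier layer of the BCG shooting window

Helper file for the support item `TypeOneIdealImplosion` (stmt-AtomisticToContinuum-15146) of the
route `ImplosionDichotomy` (`AtomisticToContinuum/HydrodynamicLimit`).

The item is proved modulo the single named fact
`Literature.Analysis.FluidPDE.BuckmasterCaolaboraGomezserrano2025_thm11_monatomic` (the `γ = 5/3`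
self-similar profile of Buckmaster–Cao-Labora–Gómez-Serrano, Thm 1.1) by
`typeOneIdealImplosion_of_thm11` (`…TypeOneIdealImplosion.lean`). In the tree that fact is reduced
(`CompressibleEulerImplosionShooting.lean`, `Shooting.thm11_monatomic_of_left`: the right barriers,
the sign change `e(r_u) < 0 < e(r_d)` and the continuity of `e` on the window `[r_d, r_u]`;
`CompressibleEulerImplosionLeftAssembly.lean`, `LeftAsm.leftData_of_hyp`: Prop. 3.1 at a given `r`
from certified near/far left barriers) to exactly one layer: the certificate data
`LeftAsm.LeftHyp r` for every `r ∈ [r_d, r_u]` (Props. 3.3, 3.5, App. B of the paper), which is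
being discharged window by window by kernel certificates.

This file records the two compositions, so that the item closes by a one-line application the
moment that layer (in either form) lands, independently of any further assembly on the Literature
side:

* `thm11_monatomic_of_leftData'` / `thm11_monatomic_of_leftHyp'` — the profile fact from
  Prop. 3.1 on the window (`LeftAsm.LeftData`) resp. from the certificate layer (`LeftAsm.LeftHyp`);
* `typeOneIdealImplosion_of_leftData` / `typeOneIdealImplosion_of_leftHyp` — the item's ledger
  signature (verbatim; the route file `Theses/ImplosionDichotomy.lean`, rev 8, renders no decl
  `TypeOneIdealImplosion`) from the same hypotheses.
-/

noncomputable section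

namespace Summit.AtomisticToContinuum.HydrodynamicLimit.Theorems

open Set MeasureTheory
open Literature.MathematicalPhysics.KineticTheory
open Literature.Analysis.FunctionSpaces
open Literature.Analysis.FluidPDE
open Literature.Analysis.FluidPDE.BuckmasterCaolaboraGomezserrano2025.Monatomic

/-- **BCG Theorem 1.1 at `γ = 5/3` from Proposition 3.1 on the shooting window**: if for every
`r ∈ [r_d, r_u]` the smooth branch through `P_s` continues to the left as a solution of the
autonomous system off the sonic lines with `Z < W`, tending to `P_∞ = (0,0)` (`LeftAsm.LeftData r`),
then the profile fact holds (`Shooting.thm11_monatomic_of_left`, hypothesis unfolded).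
[cite: BuckmasterCaolaboraGomezserrano2025, Thm 1.1, Prop. 3.1, §6] -/
theorem thm11_monatomic_of_leftData'
    (h : ∀ r ∈ Icc Shooting.rd Shooting.ru, LeftAsm.LeftData r) :
    BuckmasterCaolaboraGomezserrano2025_thm11_monatomic :=
  Shooting.thm11_monatomic_of_left fun r hr => by
    obtain ⟨Wl, Zl, δ, hδ, hgerm, hode, hoff, hW, hZ⟩ := h r hr
    exact ⟨Wl, Zl, δ, hδ, hgerm, hode, hoff, hW, hZ⟩

/-- **BCG Theorem 1.1 at `γ = 5/3` from the certified left-barrier layer**: the near (quartic)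
and far (`C¹`) left barriers of Props. 3.3/3.5 certified for every `r ∈ [r_d, r_u]`
(`LeftAsm.LeftHyp r`) give Prop. 3.1 there (`LeftAsm.leftData_of_hyp`, with the window bounds of
`Shooting.window`), hence the profile fact.
[cite: BuckmasterCaolaboraGomezserrano2025, Thm 1.1, Props. 3.1, 3.3, 3.5, §6] -/
theorem thm11_monatomic_of_leftHyp'
    (H : ∀ r ∈ Icc Shooting.rd Shooting.ru, LeftAsm.LeftHyp r) :
    BuckmasterCaolaboraGomezserrano2025_thm11_monatomic :=
  thm11_monatomic_of_leftData' fun r hr => by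
    obtain ⟨h11, h28, h3, h4, -⟩ := Shooting.window hr
    exact LeftAsm.leftData_of_hyp h3 h4 h11 h28 (H r hr)

/-- **`TypeOneIdealImplosion` (stmt-AtomisticToContinuum-15146) from Proposition 3.1 on the
shooting window** (`typeOneIdealImplosion_of_thm11 ∘ thm11_monatomic_of_leftData'`).
[cite: CaolaboraEtAl2025, Thm 1.2 + Rem 1.4 + Rem 1.5]
[cite: BuckmasterCaolaboraGomezserrano2025, Thm 1.1, Prop. 3.1] [cite: Majda1984, Ch. 2 Thm 2.1] -/
theorem typeOneIdealImplosion_of_leftData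
    (h : ∀ r ∈ Icc Shooting.rd Shooting.ru, LeftAsm.LeftData r) :
    ∃ (a₀ θ₀ : Literature.MathematicalPhysics.KineticTheory.T3 → ℝ)
      (u₀ : Literature.MathematicalPhysics.KineticTheory.T3 → Literature.MathematicalPhysics.KineticTheory.V3),
      Literature.Analysis.FunctionSpaces.Torus.IsSmooth a₀ ∧
      Literature.Analysis.FunctionSpaces.Torus.IsSmooth θ₀ ∧
      Literature.Analysis.FunctionSpaces.Torus.IsSmooth u₀ ∧ (∀ x, 0 < a₀ x) ∧ (∀ x, 0 < θ₀ x) ∧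
      ∃ (T₁ K : ℝ) (ρ₁ θ₁ : ℝ → Literature.MathematicalPhysics.KineticTheory.T3 → ℝ)
        (u₁ : ℝ → Literature.MathematicalPhysics.KineticTheory.T3 →
          Literature.MathematicalPhysics.KineticTheory.V3), 0 < T₁ ∧ 0 < K ∧
        Literature.MathematicalPhysics.KineticTheory.IsHardSphereEulerSolution 0 T₁ ρ₁ u₁ θ₁ ∧
        (∀ x, ρ₁ 0 x = a₀ x / ∫ y, a₀ y) ∧ u₁ 0 = u₀ ∧ θ₁ 0 = θ₀ ∧
        (∀ t ∈ Set.Ico 0 T₁, ∀ x, θ₁ t x = K * ρ₁ t x ^ (2 / 3 : ℝ)) ∧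
        (∃ C : ℝ, ∀ t ∈ Set.Ico 0 T₁, ∀ x, ∀ i : Fin 3,
          ‖Literature.Analysis.FunctionSpaces.Torus.partialDeriv i (u₁ t) x‖ ≤ C / (T₁ - t) ∧
          |Literature.Analysis.FunctionSpaces.Torus.partialDeriv i
              (fun y => ρ₁ t y ^ (1 / 3 : ℝ)) x| ≤ C / (T₁ - t)) ∧
        (∀ n : ℕ, n ≤ 6 → ∃ Cn pn : ℝ, ∀ t ∈ Set.Ico 0 T₁, ∀ y : EuclideanSpace ℝ (Fin 3),
          ‖iteratedFDeriv ℝ n (Literature.Analysis.FunctionSpaces.Torus.lift (ρ₁ t)) y‖ ≤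
              Cn * (T₁ - t) ^ (-pn) ∧
          ‖iteratedFDeriv ℝ n (Literature.Analysis.FunctionSpaces.Torus.lift (u₁ t)) y‖ ≤
              Cn * (T₁ - t) ^ (-pn)) ∧
        (∃ cl pl : ℝ, 0 < cl ∧ ∀ t ∈ Set.Ico 0 T₁, ∀ x, cl * (T₁ - t) ^ pl ≤ ρ₁ t x) ∧
        ∃ β c : ℝ, 0 < β ∧ 0 < c ∧ ∀ t ∈ Set.Ico 0 T₁, ∃ x, c * (T₁ - t) ^ (-β) ≤ ρ₁ t x :=
  typeOneIdealImplosion_of_thm11 (thm11_monatomic_of_leftData' h)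

/-- **`TypeOneIdealImplosion` (stmt-AtomisticToContinuum-15146) from the certified left-barrier
layer on the shooting window** (`typeOneIdealImplosion_of_thm11 ∘ thm11_monatomic_of_leftHyp'`).
[cite: CaolaboraEtAl2025, Thm 1.2 + Rem 1.4 + Rem 1.5]
[cite: BuckmasterCaolaboraGomezserrano2025, Thm 1.1, Props. 3.1, 3.3, 3.5] [cite: Majda1984, Ch. 2 Thm 2.1] -/
theorem typeOneIdealImplosion_of_leftHyp
    (H : ∀ r ∈ Icc Shooting.rd Shooting.ru, LeftAsm.LeftHyp r) :
    ∃ (a₀ θ₀ : Literature.MathematicalPhysics.KineticTheory.T3 → ℝ)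
      (u₀ : Literature.MathematicalPhysics.KineticTheory.T3 → Literature.MathematicalPhysics.KineticTheory.V3),
      Literature.Analysis.FunctionSpaces.Torus.IsSmooth a₀ ∧
      Literature.Analysis.FunctionSpaces.Torus.IsSmooth θ₀ ∧
      Literature.Analysis.FunctionSpaces.Torus.IsSmooth u₀ ∧ (∀ x, 0 < a₀ x) ∧ (∀ x, 0 < θ₀ x) ∧
      ∃ (T₁ K : ℝ) (ρ₁ θ₁ : ℝ → Literature.MathematicalPhysics.KineticTheory.T3 → ℝ)
        (u₁ : ℝ → Literature.MathematicalPhysics.KineticTheory.T3 →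
          Literature.MathematicalPhysics.KineticTheory.V3), 0 < T₁ ∧ 0 < K ∧
        Literature.MathematicalPhysics.KineticTheory.IsHardSphereEulerSolution 0 T₁ ρ₁ u₁ θ₁ ∧
        (∀ x, ρ₁ 0 x = a₀ x / ∫ y, a₀ y) ∧ u₁ 0 = u₀ ∧ θ₁ 0 = θ₀ ∧
        (∀ t ∈ Set.Ico 0 T₁, ∀ x, θ₁ t x = K * ρ₁ t x ^ (2 / 3 : ℝ)) ∧
        (∃ C : ℝ, ∀ t ∈ Set.Ico 0 T₁, ∀ x, ∀ i : Fin 3,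
          ‖Literature.Analysis.FunctionSpaces.Torus.partialDeriv i (u₁ t) x‖ ≤ C / (T₁ - t) ∧
          |Literature.Analysis.FunctionSpaces.Torus.partialDeriv i
              (fun y => ρ₁ t y ^ (1 / 3 : ℝ)) x| ≤ C / (T₁ - t)) ∧
        (∀ n : ℕ, n ≤ 6 → ∃ Cn pn : ℝ, ∀ t ∈ Set.Ico 0 T₁, ∀ y : EuclideanSpace ℝ (Fin 3),
          ‖iteratedFDeriv ℝ n (Literature.Analysis.FunctionSpaces.Torus.lift (ρ₁ t)) y‖ ≤
              Cn * (T₁ - t) ^ (-pn) ∧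
          ‖iteratedFDeriv ℝ n (Literature.Analysis.FunctionSpaces.Torus.lift (u₁ t)) y‖ ≤
              Cn * (T₁ - t) ^ (-pn)) ∧
        (∃ cl pl : ℝ, 0 < cl ∧ ∀ t ∈ Set.Ico 0 T₁, ∀ x, cl * (T₁ - t) ^ pl ≤ ρ₁ t x) ∧
        ∃ β c : ℝ, 0 < β ∧ 0 < c ∧ ∀ t ∈ Set.Ico 0 T₁, ∃ x, c * (T₁ - t) ^ (-β) ≤ ρ₁ t x :=
  typeOneIdealImplosion_of_thm11 (thm11_monatomic_of_leftHyp' H)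

end Summit.AtomisticToContinuum.HydrodynamicLimit.Theorems

end
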